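import Mathlib.Algebra.Module.ZLattice.Covolume
import Mathlib.Analysis.SpecialFunctions.Log.Basic
import Literature.Algebra.EuclideanLattices.SuccessiveMinima
import Literature.Algebra.EuclideanLattices.DualLattice
import Literature.Algebra.EuclideanLattices.DiscreteGaussian
import HarnessLib

-- provenance: harness21/H21/H21/Statements/PQC/DiscreteGaussian.lean @ 7998fb0 (interim HEAD d8f2665); M5 mechanical rewrite
/-!
# PQC family: discrete Gaussians and the smoothing parameter

Family `pqc`, trunk T-LATTICE (G10). Namespace `Literature.PQC`.

This statement file records **pqc.S23** — the discrete Gaussian `D_{L,s,c}` on a lattice and the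
smoothing parameter `η_ε(L)` (Micciancio–Regev, *Worst-case to average-case reductions based on
Gaussian measures*, SIAM J. Comput. 37 (2007), §2 and Def. 3.1).  The definitions are
`Literature.Algebra.EuclideanLattices.discreteGaussian` and `Literature.Algebra.EuclideanLattices.smoothingParameter` (prelude
`H21/Prelude/Lattice/DiscreteGaussian`); the acceptance statements here are

* `discreteGaussian_def_restate`: `D_{L,s,c}(x) = ρ_s(x - c) / ρ_{s,c}(L)` (MR07 §2), and
  `smoothingParameter_def_restate`: `η_ε(L) = inf {s > 0 | ρ_{1/s}(L* ∖ {0}) ≤ ε}` (MR07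
  Def. 3.1), both with real (definitional) proofs from the prelude;
* `smoothingParameter_two_pow_neg_le`: MR07 Lemma 3.2 in the ℓ² form of Regev 2009 Lemma 2.6,
  `η_{2⁻ⁿ}(L) ≤ √n / λ₁(L*)`;
* `smoothingParameter_le_sqrt_log_mul_successiveMinimum`: MR07 Lemma 3.3,
  `η_ε(L) ≤ √(ln(2n(1 + 1/ε))/π) · λₙ(L)`;
* `abs_gaussianMass_div_sub_one_le`: the Poisson-summation mass estimate
  `ρ_{s,c}(L) ∈ [1 - ε, 1 + ε] · sⁿ / covol(L)` for `s ≥ η_ε(L)` (Regev, *On lattices, learning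
  with errors, random linear codes, and cryptography*, J. ACM 56 (2009), Claim 3.8, where it is
  written `ρ_{r,c}(L) ∈ rⁿ det(L*) (1 ± ε)` with `det(L*) = 1/det(L)`; the same computation is the
  proof of MR07 Lemma 4.1, whose *statement* is the statistical-distance form not recorded here);
* `gaussianMass_diff_ball_le_pow_mul` / `gaussianMass_diff_ball_le`: Banaszczyk's tail bound
  (Banaszczyk, *New bounds in some transference theorems in the geometry of numbers*, Math. Ann.
  296 (1993), Lemma 1.5(i); MR07 Lemma 2.10): `ρ_s(L ∖ c s √n B) ≤ (c √(2πe) e^{-πc²})ⁿ ρ_s(L)`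
  for `c ≥ 1/√(2π)`, and its `c = 1` corollary `ρ_s(L ∖ s √n B) ≤ 2⁻ⁿ ρ_s(L)`.

## Mathlib

Mathlib has no discrete Gaussian on a lattice and no smoothing parameter (searched:
`discreteGaussian`, `smoothing`, `Banaszczyk`, `gaussianMass`; `ProbabilityTheory.gaussianReal`
is the continuous Gaussian on `ℝ`).  We use Mathlib's `IsZLattice`, `ZLattice.covolume` (default
measure `volume`), the canonical `measureSpaceOfInnerProductSpace`, and the H21 prelude notions
`Literature.Algebra.EuclideanLattices.gaussianFunction`, `gaussianMass`, `discreteGaussian`, `smoothingParameter`,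
`dualLattice`, `minNorm`, `successiveMinimum`.

## Design choices

* Ambient space: a finite-dimensional real inner product space `E` with
  `[MeasurableSpace E] [BorelSpace E]` where a covolume is needed; `L : Submodule ℤ E` with
  `[DiscreteTopology L] [IsZLattice ℝ L]` (full rank); `n = finrank ℝ E`.  The covolume is taken
  w.r.t. the canonical `volume` (the mass estimate is false for a rescaled Haar measure).
* Degenerate case `n = 0`: all statements remain true (`η_ε(⊥) = 0`, `λ₁ = λ₀ = 0`,
  `Real.log 0 = 0`, `ρ(⊥) = 1 = s⁰ / covol`), so no `finrank ℝ E ≠ 0` hypothesis is imposed.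
* `gaussianMass` is `ℝ≥0∞`-valued; the Banaszczyk bound is stated in `ℝ≥0∞` with
  `ENNReal.ofReal` constants, the mass estimate in `ℝ` via `ENNReal.toReal` (the mass of a lattice
  is finite, `Literature.Algebra.EuclideanLattices.gaussianMass_lattice_ne_top`).  The constants `2⁻ⁿ` are written as
  Monoid powers `(2⁻¹ : ℝ) ^ n` / `(2⁻¹ : ℝ≥0∞) ^ n` (no `rpow`, no `ofReal`).
* In the mass estimate the hypothesis is `η_ε(L) ≤ s` (Regev's `r ≥ η_ε(L)`) together with
  `0 < s`; the latter is automatic when `E` is nontrivial (`Literature.Algebra.EuclideanLattices.smoothingParameter_pos`,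
  which needs `[Nontrivial E]`) and only excludes the junk parameter `s ≤ 0`.
* The tail bound is stated for the complement of the *open* ball `Metric.ball 0 (c s √n)`, i.e.
  over lattice points with `‖x‖ ≥ c s √n`; Banaszczyk's proof gives this (slightly stronger) form.
  The radius is written `a * s * √n` resp. `s * √n`, so the corollary is literally `a = 1`.
* All theorems are known results in print; proofs are `sorry` except the two definitional
  restatements.
-/

noncomputable section

open Module Metric MeasureTheory Literature.Algebra.EuclideanLattices
open scoped ENNReal

namespace Literature.Algebra.EuclideanLattices

variable {E : Type*} [NormedAddCommGroup E] [InnerProductSpace ℝ E] (L : Submodule ℤ E)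

/-! ### pqc.S23: definition acceptance -/

/-- **pqc.S23** (smoothing parameter; Micciancio–Regev 2007, Def. 3.1).  The smoothing parameter
of a lattice `L` is `η_ε(L) = inf {s > 0 | ρ_{1/s}(L* ∖ {0}) ≤ ε}`, where `L*` is the dual
lattice (here the parameter `1/s` is written `s⁻¹`; the proof unfolds the definition and
normalises `1 / s` to `s⁻¹`, so it is insensitive to which spelling the prelude uses).  The
definition is `Literature.Algebra.EuclideanLattices.smoothingParameter`; this restates its defining equation. [cite: MicciancioRegev2007, Def. 3.1] -/
theorem smoothingParameter_def_restate (ε : ℝ) :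
    smoothingParameter L ε = sInf {s : ℝ | 0 < s ∧
      gaussianMass s⁻¹ 0 ((dualLattice L : Set E) \ {0}) ≤ ENNReal.ofReal ε} := by
  simp only [smoothingParameter, one_div]

variable [FiniteDimensional ℝ E] [DiscreteTopology L]

/-- **pqc.S23** (discrete Gaussian; Micciancio–Regev 2007, §2).  The discrete Gaussian
`D_{L,s,c}` on a discrete subgroup `L` of a finite-dimensional inner product space is the
probability mass function `x ↦ ρ_s(x - c) / ρ_{s,c}(L)` on `L`, where
`ρ_s(x) = exp(-π‖x‖²/s²)` and `ρ_{s,c}(L) = ∑_{y ∈ L} ρ_s(y - c)`.  The definition is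
`Literature.Algebra.EuclideanLattices.discreteGaussian`; this restates its defining equation (for `0 < s`). [cite: MicciancioRegev2007, §2] -/
theorem discreteGaussian_def_restate {s : ℝ} (hs : 0 < s) (c : E) (x : L) :
    discreteGaussian L s c x =
      ENNReal.ofReal (gaussianFunction s ((x : E) - c)) / gaussianMass s c (L : Set E) := by
  rw [discreteGaussian_apply L hs, div_eq_mul_inv]

variable [IsZLattice ℝ L]

/-! ### Bounds on the smoothing parameter (MR07 Lemmas 3.2, 3.3) -/

/-- Micciancio–Regev 2007, Lemma 3.2 (support of pqc.S23): for a full-rank lattice `L` in an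
`n`-dimensional inner product space, `η_ε(L) ≤ √n / λ₁(L*)` with `ε = 2⁻ⁿ`, where `L*` is the dual
lattice and `λ₁` the (Euclidean) minimum distance.  MR07 state Lemma 3.2 with the ℓ∞ minimum
`λ₁^∞(L*)`; the (stronger) ℓ² form recorded here is Regev, J. ACM 56 (2009), Lemma 2.6.
(For `n = 0` both sides are `0`.) [cite: MicciancioRegev2007, Lemma 3.2 (support of pqc.S23] -/
def smoothingParameter_two_pow_neg_le : Prop :=
  smoothingParameter L ((2⁻¹ : ℝ) ^ finrank ℝ E) ≤
      Real.sqrt (finrank ℝ E) / minNorm (dualLattice L)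

/-- Micciancio–Regev 2007, Lemma 3.3 (support of pqc.S23): for a full-rank lattice `L` in an
`n`-dimensional inner product space and any `ε > 0`,
`η_ε(L) ≤ √(ln(2n(1 + 1/ε)) / π) · λₙ(L)`. [cite: MicciancioRegev2007, Lemma 3.3 (support of pqc.S23] -/
def smoothingParameter_le_sqrt_log_mul_successiveMinimum : Prop :=
  ∀ {ε : ℝ} (hε : 0 < ε),
    smoothingParameter L ε ≤
      Real.sqrt (Real.log (2 * finrank ℝ E * (1 + 1 / ε)) / Real.pi) *
        successiveMinimum L (finrank ℝ E)

/-! ### Gaussian mass above the smoothing parameter (Regev 2009, Claim 3.8) -/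

/-- Regev 2009, Claim 3.8 (support of pqc.S23; the computation in the proof of Micciancio–Regev
2007, Lemma 4.1, via Poisson summation): for a full-rank lattice `L` in an `n`-dimensional inner
product space, `c ∈ E`, `ε > 0` and `s ≥ η_ε(L)` (with `s > 0`),
`ρ_{s,c}(L) ∈ [1 - ε, 1 + ε] · sⁿ / covol(L)`, i.e. `|ρ_{s,c}(L) / (sⁿ / covol(L)) - 1| ≤ ε`
(Regev writes `sⁿ det(L*)`, and `det(L*) = 1 / det(L)`).  The covolume is w.r.t. the canonical
Lebesgue measure of the inner product space. [cite: Regev2009, Claim 3.8 (support of pqc.S23] -/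
def abs_gaussianMass_div_sub_one_le : Prop :=
  ∀ [MeasurableSpace E] [BorelSpace E] {ε s : ℝ} (hε : 0 < ε) (hs : 0 < s) (hηs : smoothingParameter L ε ≤ s) (c : E),
    |(gaussianMass s c (L : Set E)).toReal / (s ^ finrank ℝ E / ZLattice.covolume L) - 1| ≤ ε

/-! ### Banaszczyk's tail bound (Banaszczyk 1993, Lemma 1.5) -/

/-- Banaszczyk 1993, Lemma 1.5(i), scaled form as in Micciancio–Regev 2007, Lemma 2.10 (support of
pqc.S23): for a full-rank lattice `L` in an `n`-dimensional inner product space, `s > 0` and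
`c ≥ 1/√(2π)`, the Gaussian mass of the lattice points of norm at least `c s √n` satisfies
`ρ_s(L ∖ c s √n B) ≤ Cⁿ ρ_s(L)` with `C = c √(2πe) e^{-πc²}` (and `C < 1` for `c > 1/√(2π)`). [cite: Banaszczyk1993, Lemma 1.5(i] -/
def gaussianMass_diff_ball_le_pow_mul : Prop :=
  ∀ {s a : ℝ} (hs : 0 < s) (ha : 1 / Real.sqrt (2 * Real.pi) ≤ a),
    gaussianMass s 0 ((L : Set E) \ ball (0 : E) (a * s * Real.sqrt (finrank ℝ E))) ≤
      ENNReal.ofReal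
          ((a * Real.sqrt (2 * Real.pi * Real.exp 1) * Real.exp (-Real.pi * a ^ 2)) ^
            finrank ℝ E) *
        gaussianMass s 0 (L : Set E)

/-- Banaszczyk 1993, Lemma 1.5(i) with `c = 1` (support of pqc.S23; Micciancio–Regev 2007,
Lemma 2.10): for a full-rank lattice `L` in an `n`-dimensional inner product space and `s > 0`,
`ρ_s(L ∖ s √n B) ≤ 2⁻ⁿ ρ_s(L)` (indeed `√(2πe) e^{-π} < 1/4`); the `a = 1` instance of
`gaussianMass_diff_ball_le_pow_mul`. [cite: MicciancioRegev2007, Lemma 2.10] -/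
def gaussianMass_diff_ball_le : Prop :=
  ∀ {s : ℝ} (hs : 0 < s),
    gaussianMass s 0 ((L : Set E) \ ball (0 : E) (s * Real.sqrt (finrank ℝ E))) ≤
      (2⁻¹ : ℝ≥0∞) ^ finrank ℝ E * gaussianMass s 0 (L : Set E)

end Literature.Algebra.EuclideanLattices
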